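import Literature.AnabelianGeometry.EtaleTheta.EtaleThetaClass
import Literature.AnabelianGeometry.EtaleTheta.ContH1Lemmas
import HarnessLib

/-!
# [EtTh] §1: Prop. 1.4 (iii) (values of the étale theta class) and Prop. 1.5 (Theta Cohomology)

Mochizuki, *The étale theta function …*, Publ. RIMS **45** (2009), §1, PRIMS PDF pp. 22–23 (printed
248–249) [cite: MochizukiEtTh2009, Prop 1.5 p.22]. Continuation of `EtaleThetaClass.lean` (split for the
400-line rule); same conventions: real `ContH1` cohomology over `ThetaSetting`, Kummer theory through
the `KummerData` interface, one `Prop`-valued predicate per printed sub-item, nothing asserted.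
Contents: `NonCuspidalPoint` (a `K̈`-rational non-cuspidal point of `Ÿ` through the interface),
`Prop14iiiKummer`, `Prop14iiiValues` (the values ARE the series `ClassicalTheta.thetaDdot` at the
coordinate), the filtrations `F1 ⊇ F2`, `Fdd1 ⊇ Fdd2` (real kernels of restriction maps), `Prop15i`,
`Prop15ii`, `Prop15iii` (the `Z`-action formula). NOT typed (listed in `EtaleThetaClass.lean`): the
cusp clause of 1.4 (iii), the inversion-automorphism clause of 1.5 (iii), "`= Ẑ · log`" identifications.
Seat abc-iut-L2-t1. HONEST FRAMING: typed ≠ proved; no side taken on anything.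
-/

noncomputable section

namespace Literature.AnabelianGeometry.EtaleTheta

open Literature.AnabelianGeometry.SemiGraphs

namespace ThetaSetting

variable {p : ℕ} [Fact p.Prime] {D : ThetaSetting p}

/-! ### Proposition 1.4 (iii): the étale theta class and the values of `Θ̈` -/

/-- A `K̈`-rational **non-cuspidal point** `y` of `Ÿ` through the interface: its decomposition group
`D_y ≤ Π^tp_Ÿ` (a section of `Π^tp_Ÿ → G_K̈` up to conjugation), its coordinate `Ü(y) ∈ K̈^×`, and the
evaluation isomorphism `H¹(D_y, Δ_Θ) ≅ H¹(G_K̈, Δ_Θ) ≅ H¹(G_K̈, Ẑ(1)) ≅ (K̈^×)^∧` (Prop. 1.4 (iii), p. 22,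
with `L = K̈`). DATA; points of `Ÿ` have no carrier here. [cite: MochizukiEtTh2009, Prop 1.4 (iii) p.22] -/
structure NonCuspidalPoint (E : D.KummerData) where
  /-- The decomposition group `D_y ⊆ Π^tp_Ÿ` of the point. -/
  Dpt : Subgroup D.PiTemp
  /-- `D_y ≤ Π^tp_Ÿ`. -/
  Dpt_le : Dpt ≤ D.GtpYdd
  /-- `D_y` maps isomorphically onto `G_K̈` (the point is `K̈`-rational): injectivity … -/
  aug_injOn : Set.InjOn D.aug Dpt
  /-- … and image `G_K̈`. -/
  map_aug_Dpt : Dpt.map D.aug.toMonoidHom = D.GKdd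
  /-- The coordinate `Ü(y) ∈ K̈^×` of the point (`Ü ∈ Γ(Ü, O^×_Ü)`, p. 21). -/
  coord : (↥D.Kdd)ˣ
  /-- `y` is non-cuspidal: `Ü(y) ≠ ±q̈^a` (the cusps of `Ÿ` are the zeros `±q̈^a` of `Θ̈`, Prop. 1.4 (i)). -/
  coord_ne_cusp : ∀ a : ℤ, ((coord : D.Kdd) : PadicAlgCl p) ≠ D.qdd ^ a ∧
    ((coord : D.Kdd) : PadicAlgCl p) ≠ -(D.qdd ^ a)
  /-- "the restricted classes `… |_y ∈ H¹(G_L, Δ_Θ) ≅ H¹(G_L, Ẑ(1)) ≅ (L^×)^∧`" (p. 22): the evaluation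
  map at `y`. -/
  evalAt : D.H1 Dpt →* E.KddHat
  /-- Evaluation at `y` of (the restriction of) a Kummer class of a constant `c ∈ K̈^×` returns `c`. -/
  evalAt_kum : ∀ c : E.KddHat,
    evalAt (ContH1.res D.toTheta D.DeltaTheta Dpt_le (D.inflTheta D.GtpYdd (E.kumYdd c))) = c

/-- **Prop. 1.4 (iii)**, first sentence (p. 22): "The classes `O^×_K̈ · η̈^Θ ∈ H¹(Π^tp_Ÿ, Δ_Θ)` … are
precisely the 'Kummer classes' associated to `O^×_K̈`-multiples of `Θ̈`, regarded as a regular function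
on `Ÿ`" — typed relative to a datum `κΘ̈ ∈ H¹(Π^tp_Ÿ, Δ_Θ)`, the Kummer class of the function `Θ̈`
(the Kummer map of FUNCTIONS is [EtTh] §5 / plan LLANA N13, not modelled here): the theta classes are
exactly the `O^×_K̈`-translates of `κΘ̈`. [cite: MochizukiEtTh2009, Prop 1.4 (iii) p.22] -/
def Prop14iiiKummer (E : D.EtaleThetaData) (kummerTheta : D.H1 D.GtpYdd) : Prop :=
  E.thetaClasses = {x | ∃ k ∈ E.kumUnitsYdd, x = k * kummerTheta}

/-- **Prop. 1.4 (iii)**, values (p. 22): "if … `y ∈ Ÿ(L)` is a non-cuspidal point, then the restricted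
classes `O^×_K̈ · η̈^Θ|_y ∈ H¹(G_L, Δ_Θ) ≅ H¹(G_L, Ẑ(1)) ≅ (L^×)^∧ … lie in `L^× ⊆ (L^×)^∧` and are equal to
the values `O^×_K̈ · Θ̈(y)`" — here for `L = K̈`, with `Θ̈(y)` THE SERIES of Prop. 1.4 evaluated at the
coordinate `Ü(y)`, summed in `ℚ̄_p = PadicAlgCl p` (`ClassicalTheta.thetaDdot`; the value lies in `K̈`). (Cusp clause via the
canonical integral structure of [GalSect] Def. 4.1 (iii): not typed.) [cite: MochizukiEtTh2009, Prop 1.4 (iii) p.22] -/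
def Prop14iiiValues (E : D.EtaleThetaData) : Prop :=
  ∀ (y : NonCuspidalPoint E.toKummerData) (x : D.H1 D.GtpYdd), x ∈ E.thetaClasses →
    ∃ (a : (↥D.Kdd)ˣ) (_ : a ∈ D.unitsOKdd) (v : (↥D.Kdd)ˣ),
      ((v : D.Kdd) : PadicAlgCl p) = thetaDdot D.qdd ((y.coord : D.Kdd) : PadicAlgCl p) ∧
      y.evalAt (ContH1.res D.toTheta D.DeltaTheta y.Dpt_le x) = E.toKddHat (a * v)

/-! ### Proposition 1.5 (Theta Cohomology) -/

/-- `F¹ ⊆ H¹((Π^tp_Y)^Θ, Δ_Θ)`: the kernel of restriction to `Δ_Θ` — the first step of "the natural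
filtration `0 ⊆ F² ⊆ F¹ ⊆ F⁰ = H¹((Π^tp_Y)^Θ, Δ_Θ)`" determined by `Δ_Θ ⊆ (Δ^tp_Y)^Θ ⊆ (Π^tp_Y)^Θ`
(Prop. 1.5 (i), p. 23; `F⁰/F¹ = Hom(Δ_Θ, Δ_Θ)`). [cite: MochizukiEtTh2009, Prop 1.5 (i) p.23] -/
def F1 (hC : D.Compat) : Subgroup (D.H1Theta (D.GtpY.map D.toTheta)) :=
  (ContH1.res (MonoidHom.id D.GtpTheta) D.DeltaTheta
    (hC.deltaTheta_le_DtpYTheta.trans (Subgroup.map_mono inf_le_left))).ker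

/-- `F² ⊆ H¹((Π^tp_Y)^Θ, Δ_Θ)`: the kernel of restriction to `(Δ^tp_Y)^Θ` (Prop. 1.5 (i), p. 23;
`F² = H¹(G_K, Δ_Θ)`). [cite: MochizukiEtTh2009, Prop 1.5 (i) p.23] -/
def F2 : Subgroup (D.H1Theta (D.GtpY.map D.toTheta)) :=
  (ContH1.res (MonoidHom.id D.GtpTheta) D.DeltaTheta
    (Subgroup.map_mono inf_le_left : D.DtpYTheta ≤ D.GtpY.map D.toTheta)).ker

/-- `F̈¹ ⊆ H¹((Π^tp_Ÿ)^Θ, Δ_Θ)`: kernel of restriction to `Δ_Θ` (Prop. 1.5 (ii), p. 23).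
[cite: MochizukiEtTh2009, Prop 1.5 (ii) p.23] -/
def Fdd1 (hC : D.Compat) : Subgroup (D.H1Theta (D.GtpYdd.map D.toTheta)) :=
  (ContH1.res (MonoidHom.id D.GtpTheta) D.DeltaTheta
    (hC.deltaTheta_le_DtpYddTheta.trans (Subgroup.map_mono inf_le_left))).ker

/-- `F̈² ⊆ H¹((Π^tp_Ÿ)^Θ, Δ_Θ)`: kernel of restriction to `(Δ^tp_Ÿ)^Θ` (Prop. 1.5 (ii), p. 23).
[cite: MochizukiEtTh2009, Prop 1.5 (ii) p.23] -/
def Fdd2 : Subgroup (D.H1Theta (D.GtpYdd.map D.toTheta)) :=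
  (ContH1.res (MonoidHom.id D.GtpTheta) D.DeltaTheta
    (Subgroup.map_mono inf_le_left : (D.DtpYddN 1).map D.toTheta ≤ D.GtpYdd.map D.toTheta)).ker

/-- `F² ⊆ F¹` ("`0 ⊆ F² ⊆ F¹ ⊆ F⁰`", Prop. 1.5 (i), p. 23) — PROVED: restriction to `Δ_Θ` factors through
restriction to `(Δ^tp_Y)^Θ ⊇ Δ_Θ`. [cite: MochizukiEtTh2009, Prop 1.5 (i) p.23] -/
theorem F2_le_F1 (hC : D.Compat) : (F2 : Subgroup (D.H1Theta (D.GtpY.map D.toTheta))) ≤ F1 hC := by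
  intro x hx
  have h12 : D.DeltaTheta ≤ D.DtpYTheta := hC.deltaTheta_le_DtpYTheta
  have h23 : D.DtpYTheta ≤ D.GtpY.map D.toTheta := Subgroup.map_mono inf_le_left
  have hx' : ContH1.res (MonoidHom.id D.GtpTheta) D.DeltaTheta h23 x = 1 := hx
  have key := ContH1.res_res (φ := MonoidHom.id D.GtpTheta) (A := D.DeltaTheta) h12 h23 x
  rw [hx', map_one] at key
  exact key.symm

/-- `F̈² ⊆ F̈¹` (Prop. 1.5 (ii), p. 23) — PROVED likewise. [cite: MochizukiEtTh2009, Prop 1.5 (ii) p.23] -/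
theorem Fdd2_le_Fdd1 (hC : D.Compat) :
    (Fdd2 : Subgroup (D.H1Theta (D.GtpYdd.map D.toTheta))) ≤ Fdd1 hC := by
  intro x hx
  have h12 : D.DeltaTheta ≤ (D.DtpYddN 1).map D.toTheta := hC.deltaTheta_le_DtpYddTheta
  have h23 : (D.DtpYddN 1).map D.toTheta ≤ D.GtpYdd.map D.toTheta := Subgroup.map_mono inf_le_left
  have hx' : ContH1.res (MonoidHom.id D.GtpTheta) D.DeltaTheta h23 x = 1 := hx
  have key := ContH1.res_res (φ := MonoidHom.id D.GtpTheta) (A := D.DeltaTheta) h12 h23 x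
  rw [hx', map_one] at key
  exact key.symm

/-- **Prop. 1.5 (i) (Theta Cohomology on `Y`)** (pp. 22–23), the typeable content of
"`F⁰/F¹ = Hom(Δ_Θ, Δ_Θ) = Ẑ · log(Θ)`, `F¹/F² = Hom((Δ^tp_Y)^ell/Δ_Θ, Δ_Θ) = Ẑ · log(U)` [sic, module
READING NOTES], `F² = H¹(G_K, Δ_Θ) →̃ H¹(G_K, Ẑ(1)) →̃ (K^×)^∧`": restriction to `Δ_Θ` is SURJECTIVE onto
`Hom(Δ_Θ, Δ_Θ)`; `log(U) ∈ F¹`; `F² = ` the image of `(K^×)^∧`. [cite: MochizukiEtTh2009, Prop 1.5 (i) p.23] -/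
structure Prop15i (E : D.KummerData) (hC : D.Compat) : Prop where
  /-- `F⁰ ↠ F⁰/F¹ = Hom(Δ_Θ, Δ_Θ)`: restriction to `Δ_Θ` is surjective. -/
  res_deltaTheta_surjective : Function.Surjective
    (ContH1.res (MonoidHom.id D.GtpTheta) D.DeltaTheta
      (hC.deltaTheta_le_DtpYTheta.trans (Subgroup.map_mono inf_le_left)) :
      D.H1Theta (D.GtpY.map D.toTheta) → D.H1Theta D.DeltaTheta)
  /-- `log(U) ∈ F¹` (it generates `F¹/F²`). -/
  logU_mem_F1 : E.logU ∈ F1 hC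
  /-- `F² = H¹(G_K, Δ_Θ) ≅ (K^×)^∧`: `F²` is the image of the Kummer injection. -/
  F2_eq : (F2 : Subgroup (D.H1Theta (D.GtpY.map D.toTheta))) = E.kumY.range

/-- **Prop. 1.5 (ii) (Theta Cohomology on `Ÿ`)** (p. 23): the same for
`0 ⊆ F̈² ⊆ F̈¹ ⊆ F̈⁰ = H¹((Π^tp_Ÿ)^Θ, Δ_Θ)` with "`F̈⁰/F̈¹ = Hom(Δ_Θ, Δ_Θ) = Ẑ · log(Θ)`,
`F̈¹/F̈² = Hom((Δ^tp_Ÿ)^ell/Δ_Θ, Δ_Θ) = Ẑ · log(Ü)`, `F̈² = H¹(G_K̈, Δ_Θ) →̃ (K̈^×)^∧` — where we write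
`log(Ü) := ½ · log(U)`". [cite: MochizukiEtTh2009, Prop 1.5 (ii) p.23] -/
structure Prop15ii (E : D.KummerData) (hC : D.Compat) : Prop where
  /-- Restriction to `Δ_Θ` is surjective onto `Hom(Δ_Θ, Δ_Θ)`. -/
  res_deltaTheta_surjective : Function.Surjective
    (ContH1.res (MonoidHom.id D.GtpTheta) D.DeltaTheta
      (hC.deltaTheta_le_DtpYddTheta.trans (Subgroup.map_mono inf_le_left)) :
      D.H1Theta (D.GtpYdd.map D.toTheta) → D.H1Theta D.DeltaTheta)
  /-- `log(Ü) ∈ F̈¹`. -/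
  logUdd_mem_Fdd1 : E.logUdd ∈ Fdd1 hC
  /-- `F̈² = H¹(G_K̈, Δ_Θ) ≅ (K̈^×)^∧`. -/
  Fdd2_eq : (Fdd2 : Subgroup (D.H1Theta (D.GtpYdd.map D.toTheta))) = E.kumYdd.range

/-- **Prop. 1.5 (iii)** (p. 23): "Any class `η̈^Θ ∈ H¹(Π^tp_Ÿ, Δ_Θ)` arises from a unique class
`η̈^Θ ∈ H¹((Π^tp_Ÿ)^Θ, Δ_Θ)` that maps to `log(Θ)` in the quotient `F̈⁰/F̈¹` and on which
`a ∈ Z ≅ Π^tp_X/Π^tp_Y` acts as follows: `η̈^Θ ↦ η̈^Θ − 2a · log(Ü) − (a²/2) · log(q_X) + log(O^×_K̈)`"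
(additive notation for our multiplicative `H¹`; `(a²/2) · log(q_X) = a² · log(q̈)` as `q_X = q̈²` in `K̈`;
the action of `a = ` the image of `σ ∈ Π^tp_X` is conjugation by `σ`). NOT typed: the clause on
inversion automorphisms `ι` (fixes `η̈^Θ + log(O^×_K̈)`, negates `log(Ü) + log(O^×_K̈)`).
[cite: MochizukiEtTh2009, Prop 1.5 (iii) p.23] -/
def Prop15iii (E : D.EtaleThetaData) (hC : D.Compat) : Prop :=
  ∀ x ∈ E.thetaClasses, ∃! x' : D.H1Theta (D.GtpYdd.map D.toTheta),
    D.inflTheta D.GtpYdd x' = x ∧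
    ContH1.res (MonoidHom.id D.GtpTheta) D.DeltaTheta
      (hC.deltaTheta_le_DtpYddTheta.trans (Subgroup.map_mono inf_le_left)) x' = D.logTheta ∧
    ∀ σ : D.PiTemp, ∃ u ∈ D.unitsOKdd,
      haveI := hC.GtpYddTheta_normal
      ContH1.conj (MonoidHom.id D.GtpTheta) D.DeltaTheta (D.toTheta σ) x' =
        x' * E.logUdd ^ (-(2 * Multiplicative.toAdd (D.toZ σ)))
           * E.kumYdd (E.toKddHat D.qddUnit) ^
              (-(Multiplicative.toAdd (D.toZ σ) * Multiplicative.toAdd (D.toZ σ)))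
           * E.kumYdd (E.toKddHat u)

end ThetaSetting

end Literature.AnabelianGeometry.EtaleTheta

end
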